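import Summits.CriticalPhenomena.PercolationContinuityZ3.Theorems.PercNearOneGluingNoHeavyLowerTailKnQuestion8CoefficientwiseOneSidedDomination
import Summits.CriticalPhenomena.PercolationContinuityZ3.Theorems.PercNearOneGluingNoHeavyLowerTailKnQuestion8CoefficientwiseMirrorWeighted
import HarnessLib

/-!
# Coefficientwise van den Berg–Häggström–Kahn Theorem 1.4 (negative correlation of the clusters of `x` and `z` given `x ↮ z`) for a pendant `z`

Support file (`--supports stmt-CriticalPhenomena-4575`, closed), prover `prim-lf-2` (gen 29).  No definitions, no named facts, no sorries; standard axioms.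
Memo `prim-lf-2/CW-VDBHK-gen29.md` (§1).

For the uniform two-colouring `s / sᶜ` of the edges of a finite multigraph with `S = {z ∉ C_x(s)} ∩ {z ∉ C_x(sᶜ)}` ('no monochromatic `x–z` path'),
prim-lf-2 gen 29 conjectures (exact census, 0 negatives through all graphs on 6 vertices and random graphs on 7) the coefficientwise form of
[cite: VandenbergHaggstromKahn2005, Thm. 1.4 p. 5]:
  `Σ_{s ∈ S} (f(C_x s) − f(C_x sᶜ))·(g(C_z s) − g(C_z sᶜ)) ≤ 0`   for monotone `f, g`   (CW-NEG),
i.e. every joint Bernstein coefficient of `E[f(C_x)g(C_z); x↮z]·P(x↮z) − E[f(C_x); x↮z]·E[g(C_z); x↮z]` is `≤ 0`.  This file proves it when `z` is a leaf: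
* (reused from `…CoefficientwiseMirrorWeighted`: `openCluster_leaf_eq`, `openCluster_leaf_insert` — the cluster of a leaf `z` (pendant edge
  `e₀ = {z,v}`) is `{z}` without `e₀` and `{z} ∪ C_v` with it);
* `Coefficientwise.cwneg_pendant` — CW-NEG for pendant `z`: resolving the colour of `e₀` turns the sum into
  `2·Σ_{t ⊆ E∖e₀ : v ∉ C_x(t)} ψ(C_v t)·(f(C_x t) − f(C_x(E∖e₀∖t)))` with `ψ(W) = g({z} ∪ W) − g({z}) ≥ 0`, which is `≤ 0` by one-sided domination
  (`offCluster_domination` with `A = {v}`).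
[cite: KozmaNitzan2024, Questions 8–9 (§5.5 p. 36) (context: the Question-8 pocket covariance programme of which this is the k = 2 rung)]
-/

namespace Summit.CriticalPhenomena.PercolationContinuityZ3.Theorems

open Finset Literature.Probability.Percolation

namespace Coefficientwise

variable {ι V : Type*}

variable [Fintype ι] [DecidableEq ι]

open Classical in
/-- **Coefficientwise van den Berg–Häggström–Kahn Theorem 1.4 for a pendant `z` (CW-NEG, leaf case).**  If `z` is a leaf of the multigraph (`e₀ = {z,v}` its only
edge, `z ≠ v`, `z ≠ x`), then for monotone `f, g : Set V → ℝ`, with `S = {z ∉ C_x(s)} ∩ {z ∉ C_x(sᶜ)}` ('no monochromatic `x–z` path'),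
  `Σ_{s ∈ S} (f(C_x s) − f(C_x sᶜ))·(g(C_z s) − g(C_z sᶜ)) ≤ 0`,
i.e. under the uniform two-colouring conditioned on `S`, the antisymmetrised monotone functionals of the `x`-cluster and of the `z`-cluster are negatively
correlated — the count-one Bernstein coefficient of `E[f(C_x) g(C_z) | x ↮ z] ≤ E[f(C_x)|x↮z]·E[g(C_z)|x↮z]` [cite: VandenbergHaggstromKahn2005, Thm. 1.4 p. 5]
on every minor in which `z` is pendant.  Proof: resolve the colour of `e₀`; on `{e₀ red}` the constraint is `v ∉ C_x` off `e₀` and `C_z = {z} ∪ C_v`, `C_z(blue) = {z}`;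
the two halves agree under the colour swap and each is `offCluster_domination` with `A = {v}` and weight `ψ(W) = g({z} ∪ W) − g({z}) ≥ 0`.  (prim-lf-2 gen 29.)
[cite: KozmaNitzan2024, Questions 8–9 (§5.5 p. 36) (context)] -/
theorem cwneg_pendant (ends : ι → Sym2 V) {z v x : V} {e₀ : ι} (he₀ : ends e₀ = s(z, v))
    (hpend : ∀ i, z ∈ ends i → i = e₀) (hzx : z ≠ x) (hzv : z ≠ v) (f g : Set V → ℝ) (hf : Monotone f) (hg : Monotone g) :
    ∑ s ∈ univ.filter (fun s : Finset ι => z ∉ openCluster (ends '' (↑s : Set ι)) x ∧ z ∉ openCluster (ends '' (↑(sᶜ) : Set ι)) x),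
      (f (openCluster (ends '' (↑s : Set ι)) x) - f (openCluster (ends '' (↑(sᶜ) : Set ι)) x)) *
        (g (openCluster (ends '' (↑s : Set ι)) z) - g (openCluster (ends '' (↑(sᶜ) : Set ι)) z)) ≤ 0 := by
  set K : Finset ι → Set V := fun s => openCluster (ends '' (↑s : Set ι)) x with hK
  set Cv : Finset ι → Set V := fun s => openCluster (ends '' (↑s : Set ι)) v with hCv
  set Cz : Finset ι → Set V := fun s => openCluster (ends '' (↑s : Set ι)) z with hCz
  set E' : Finset ι := univ.erase e₀ with hE'
  set ψ : Set V → ℝ := fun W => g (insert z W) - g {z} with hψ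
  have hψ0 : ∀ W, 0 ≤ ψ W := fun W => by
    simp only [hψ, sub_nonneg]
    exact hg (Set.singleton_subset_iff.mpr (Set.mem_insert z W))
  -- the weighted one-sided sum on `G − e₀`
  set Ω : Finset ι → ℝ := fun t => ψ (Cv t) * (f (K t) - f (K (E' \ t))) with hΩ
  change ∑ s ∈ univ.filter (fun s : Finset ι => z ∉ K s ∧ z ∉ K sᶜ), (f (K s) - f (K sᶜ)) * (g (Cz s) - g (Cz sᶜ)) ≤ 0
  have he₀E' : e₀ ∉ E' := fun h => (Finset.mem_erase.mp h).1 rfl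
  have huniv : (univ : Finset (Finset ι)) = (insert e₀ E').powerset := by
    rw [hE', Finset.insert_erase (Finset.mem_univ e₀), Finset.powerset_univ]
  -- OSD on the sub-multigraph `E'` (transported along `{i // i ∈ E'}`), with `A = {v}`
  have hbase : ∑ t ∈ E'.powerset.filter (fun t : Finset ι => v ∉ K t), Ω t ≤ 0 := by
    set emb : {i // i ∈ E'} ↪ ι := Function.Embedding.subtype _ with hemb
    have key := offCluster_domination (ends ∘ Subtype.val : {i // i ∈ E'} → Sym2 V) x ({v} : Set V) f hf ψ hψ0
    have map_compl : ∀ t : Finset {i // i ∈ E'}, (tᶜ).map emb = E' \ t.map emb := by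
      intro t
      ext i
      simp only [Finset.mem_map, Finset.mem_compl, Finset.mem_sdiff, hemb, Function.Embedding.coe_subtype]
      constructor
      · rintro ⟨⟨j, hj⟩, hjt, rfl⟩
        exact ⟨hj, fun ⟨⟨k, hk⟩, hkt, hkj⟩ => hjt (by cases hkj; exact hkt)⟩
      · rintro ⟨hiE, hnot⟩
        exact ⟨⟨i, hiE⟩, fun hit => hnot ⟨⟨i, hiE⟩, hit, rfl⟩, rfl⟩
    have map_sub : ∀ t : Finset {i // i ∈ E'}, t.map emb ⊆ E' := by
      intro t i hi
      obtain ⟨⟨j, hj⟩, _, rfl⟩ := Finset.mem_map.mp hi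
      exact hj
    have hRv : ∀ (u : Finset ι), {y | ∃ a ∈ ({v} : Set V), y ∈ openCluster (ends '' (↑u : Set ι)) a} = Cv u := by
      intro u; ext y; simp [hCv]
    refine le_of_eq_of_le ?_ key
    refine Finset.sum_bij' (fun t _ => t.subtype (· ∈ E')) (fun t _ => t.map emb) ?_ ?_ ?_ ?_ ?_
    · intro t ht
      rw [Finset.mem_filter] at ht ⊢
      refine ⟨Finset.mem_univ _, ?_⟩
      have hsub : t ⊆ E' := Finset.mem_powerset.mp ht.1
      intro a ha
      rw [Set.mem_singleton_iff.mp ha, image_map_subtype, Finset.subtype_map_of_mem (fun i hi => hsub hi)]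
      exact ht.2
    · intro t ht
      rw [Finset.mem_filter] at ht ⊢
      refine ⟨Finset.mem_powerset.mpr (map_sub t), ?_⟩
      have := ht.2 v rfl
      rw [image_map_subtype] at this
      exact this
    · intro t ht
      have hsub : t ⊆ E' := Finset.mem_powerset.mp (Finset.mem_filter.mp ht).1
      exact Finset.subtype_map_of_mem (fun i hi => hsub hi)
    · intro t _
      ext ⟨i, hi⟩
      rw [Finset.mem_subtype, Finset.mem_map]
      constructor
      · rintro ⟨⟨j, hj⟩, hjt, hji⟩
        have hji' : j = i := by simpa [hemb] using hji
        subst hji'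
        exact hjt
      · intro h; exact ⟨⟨i, hi⟩, h, by simp [hemb]⟩
    · intro t ht
      have hsub : t ⊆ E' := Finset.mem_powerset.mp (Finset.mem_filter.mp ht).1
      have hmap : (t.subtype (· ∈ E')).map emb = t := Finset.subtype_map_of_mem (fun i hi => hsub hi)
      rw [image_map_subtype, image_map_subtype ends E' ((t.subtype (· ∈ E'))ᶜ), map_compl, hmap, hRv]
  -- complements inside `E'`
  have compl_of_sub : ∀ t, t ⊆ E' → tᶜ = insert e₀ (E' \ t) := by
    intro t ht
    ext i
    simp only [Finset.mem_compl, Finset.mem_insert, Finset.mem_sdiff, hE', Finset.mem_erase, Finset.mem_univ, and_true]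
    constructor
    · intro hi
      by_cases hie : i = e₀
      · exact Or.inl hie
      · exact Or.inr ⟨hie, hi⟩
    · rintro (rfl | ⟨_, hi⟩)
      · exact fun h => he₀E' (ht h)
      · exact hi
  have compl_insert_of_sub : ∀ t, t ⊆ E' → (insert e₀ t)ᶜ = E' \ t := by
    intro t ht
    ext i
    simp only [Finset.mem_compl, Finset.mem_insert, Finset.mem_sdiff, hE', Finset.mem_erase, Finset.mem_univ, and_true, not_or]
  have notin_of_sub : ∀ t, t ⊆ E' → e₀ ∉ t := fun t ht h => he₀E' (ht h)
  have notin_sdiff : ∀ t, e₀ ∉ E' \ t := fun t h => he₀E' (Finset.mem_sdiff.mp h).1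
  -- clusters of the leaf
  have Cz_off : ∀ t, e₀ ∉ t → Cz t = {z} := fun t ht => openCluster_leaf_eq ends hpend ht
  have Cz_on : ∀ t, e₀ ∉ t → Cz (insert e₀ t) = insert z (Cv t) := fun t ht => openCluster_leaf_insert ends he₀ hpend hzv ht
  -- split along `e₀`
  rw [Finset.sum_filter, huniv, Finset.sum_powerset_insert he₀E']
  -- the `e₀ ∉ s` half: `s = t ⊆ E'`, `sᶜ = insert e₀ (E' \ t)`
  have h1 : ∑ t ∈ E'.powerset, (if z ∉ K t ∧ z ∉ K tᶜ then (f (K t) - f (K tᶜ)) * (g (Cz t) - g (Cz tᶜ)) else 0) =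
      ∑ t ∈ E'.powerset, (if v ∉ K (E' \ t) then Ω (E' \ t) else 0) := by
    refine Finset.sum_congr rfl fun t ht => ?_
    have hsub : t ⊆ E' := Finset.mem_powerset.mp ht
    have hzt : z ∉ K t := leaf_not_mem_openCluster ends hpend hzx (notin_of_sub t hsub)
    rw [compl_of_sub t hsub]
    by_cases hv : v ∈ K (E' \ t)
    · have hz : z ∈ K (insert e₀ (E' \ t)) := (leaf_mem_openCluster_insert_iff ends he₀ hpend hzx hzv (notin_sdiff t)).mpr hv
      simp [hz, hv]
    · have hKc : K (insert e₀ (E' \ t)) = K (E' \ t) := openCluster_insert_pendant ends he₀ hpend hzx (notin_sdiff t) hv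
      have hzc : z ∉ K (E' \ t) := leaf_not_mem_openCluster ends hpend hzx (notin_sdiff t)
      rw [hKc]
      simp only [hzt, hzc, hv, not_false_eq_true, and_self, if_true, hΩ]
      rw [Cz_off t (notin_of_sub t hsub), Cz_on (E' \ t) (notin_sdiff t), Finset.sdiff_sdiff_eq_self hsub]
      simp only [hψ]
      ring
  -- the `e₀ ∈ s` half: `s = insert e₀ t`, `sᶜ = E' \ t`
  have h2 : ∑ t ∈ E'.powerset, (if z ∉ K (insert e₀ t) ∧ z ∉ K (insert e₀ t)ᶜ then
        (f (K (insert e₀ t)) - f (K (insert e₀ t)ᶜ)) * (g (Cz (insert e₀ t)) - g (Cz (insert e₀ t)ᶜ)) else 0) =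
      ∑ t ∈ E'.powerset, (if v ∉ K t then Ω t else 0) := by
    refine Finset.sum_congr rfl fun t ht => ?_
    have hsub : t ⊆ E' := Finset.mem_powerset.mp ht
    rw [compl_insert_of_sub t hsub]
    have hzc : z ∉ K (E' \ t) := leaf_not_mem_openCluster ends hpend hzx (notin_sdiff t)
    by_cases hv : v ∈ K t
    · have hz : z ∈ K (insert e₀ t) := (leaf_mem_openCluster_insert_iff ends he₀ hpend hzx hzv (notin_of_sub t hsub)).mpr hv
      simp [hz, hv]
    · have hKi : K (insert e₀ t) = K t := openCluster_insert_pendant ends he₀ hpend hzx (notin_of_sub t hsub) hv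
      have hzt : z ∉ K t := leaf_not_mem_openCluster ends hpend hzx (notin_of_sub t hsub)
      rw [hKi]
      simp only [hzt, hzc, hv, not_false_eq_true, and_self, if_true, hΩ]
      rw [Cz_on t (notin_of_sub t hsub), Cz_off (E' \ t) (notin_sdiff t)]
      simp only [hψ]
      ring
  -- the first half equals the second by the colour swap inside `E'`
  have h3 : ∑ t ∈ E'.powerset, (if v ∉ K (E' \ t) then Ω (E' \ t) else 0) = ∑ t ∈ E'.powerset, (if v ∉ K t then Ω t else 0) := by
    refine Finset.sum_bij' (fun t _ => E' \ t) (fun t _ => E' \ t) ?_ ?_ ?_ ?_ ?_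
    · intro t _; exact Finset.mem_powerset.mpr Finset.sdiff_subset
    · intro t _; exact Finset.mem_powerset.mpr Finset.sdiff_subset
    · intro t ht; exact Finset.sdiff_sdiff_eq_self (Finset.mem_powerset.mp ht)
    · intro t ht; exact Finset.sdiff_sdiff_eq_self (Finset.mem_powerset.mp ht)
    · intro t ht; rfl
  rw [h1, h2, h3, ← Finset.sum_filter]
  linarith [hbase]

end Coefficientwise

end Summit.CriticalPhenomena.PercolationContinuityZ3.Theorems
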